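import Literature.NumberTheory.EllipticCurves.BDPAnticyclotomicPAdicLFunction
import Literature.NumberTheory.GaloisRepresentations.WeilLAdicCharacterProofs
import Literature.NumberTheory.GaloisRepresentations.CMTypeHeckeCharacter
import HarnessLib

/-!
# X11b @ `p = 3`, S24-a (λ-supply), part (B): `p`-adic avatars of Hecke characters as PLAIN
# characters `Γ_K → ℚ̄_pˣ` — the dictionary `IsPAdicAvatarOf`/`FactorsThroughZp` ↔ determinant,
# products, inverses, Weil's avatar, and the finite-order (class-field-theoretic) avatar

HONEST FRAMING (cell `b2b-bsdres`, run/shared/lean/b2b/bsd-rank1-residual/, verbatim in every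
file): the goal of the cell is to DELETE the COMBINATION-SHAPED residual classes of the
Birch–Swinnerton-Dyer formula for ALL analytic-rank `≤ 1` elliptic curves over `ℚ` — assembled
STRICTLY from published theorems — so that the rank-`≤ 1` remainder becomes exactly the
CONSTRUCTION-SHAPED classes, which are TYPED, NOT attempted. This is not "finishing BSD". Team N8/O2
(X11b at `3`: `3 ‖ N`, `r_an = 1`, `E[3]` irreducible): research route; nothing booked; NO label
changes; O2 stays OPEN. THEOREMS ONLY; no definition, no fact, no `sorry`. Every class-field-theoretic
input is a PROVED theorem of the tree (`artinReciprocity_character_holds`, Weil 1956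
`HeckeCharacter.IsAlgebraic.exists_lAdic`).

PROVENANCE: sub-target S24 'λ-SUPPLY SPLIT' (OWNERS R7-59), seat `b2b-bsdres-x11b3-p7` (gen. 4);
feasibility census `HOME/b2b-bsdres-x11b3-p7/s24/S24-FEASIBILITY.md` step (B).

## What this file proves

Throughout, for a Hecke character `χ` of a number field `K`, a prime `p`, `ι : ℚ̄_p ≃+* ℂ` and a
PLAIN character `θ : Γ_K →* ℚ̄_pˣ`, "`θ` is an avatar of `χ`" is the spelled-out condition (no
definition is introduced): at every finite `v ∤ p` where `χ` is unramified, `θ` kills every inertia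
group above `v` and `θ(Φ) = ι⁻¹(χ(ϖ_v))⁻¹` for every arithmetic Frobenius `Φ` above `v` — the
determinant form of the tree's `IsPAdicAvatarOf ι χ r` for the framed `r` with `det ∘ r = θ`
(`isPAdicAvatarOf_iff_det`, `factorsThroughZp_iff_det`, `exists_framed_of_continuous`: every
continuous `θ` is `det ∘ r`).
* §2 the condition is multiplicative and stable under inverses for characters unramified outside
  `p` (`avatar_mul`, `avatar_inv`).
* §3 Weil 1956 in this currency: an algebraic `χ` has a CONTINUOUS avatar `θ`
  (`exists_avatar_of_isAlgebraic`, from `HeckeCharacter.IsAlgebraic.exists_lAdic`).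
* §4 the finite-order dictionary (global class field theory, PROVED in the tree): a character
  `θ : Γ_K →* ℚ̄_pˣ` with OPEN KERNEL is the avatar of a finite-order Hecke character `μ`, which is
  unramified at every `v` all of whose inertia groups `θ` kills (`exists_hecke_of_isOpen_ker`;
  `heckeOfArtinCharacter_spec` + `isUnramifiedAt_of_heckeCharacter_isUnramifiedAt`), and such `μ`
  is unitary of infinity type `(0,0)` (`hasInfinityType_zero_of_isFiniteOrder`).

## References

* [Weil1956] A. Weil, *On a certain type of characters of the idèle-class group of an algebraic
  number-field* (1956), §1–§2.
* [SerreAbelianLadic1968] J.-P. Serre, *Abelian ℓ-adic representations and elliptic curves* (1968),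
  Ch. II §2.7, Ch. III §2.3.
* [CasselsFrohlichANT1967] J. Tate, *Global class field theory*, Ch. VII §5.1.
-/

noncomputable section

open scoped Polynomial
open Polynomial NumberField IsDedekindDomain Field

namespace Summit.BirchSwinnertonDyer.Rank1Residual.X11b.Three.LambdaSupply

open Literature.NumberTheory.GaloisRepresentations Literature.NumberTheory.EllipticCurves
  Literature.NumberTheory.Automorphic

/-! ### §1. Rank-one framed representations vs plain characters -/

section Det

variable {K : Type} [Field K] {A : Type*} [CommRing A] [TopologicalSpace A]

omit [TopologicalSpace A] in
/-- A `1 × 1` invertible matrix is determined by its determinant. [folklore] -/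
theorem gl_one_eq_iff_det_eq (g h : GL (Fin 1) A) :
    g = h ↔ Matrix.GeneralLinearGroup.det g = Matrix.GeneralLinearGroup.det h := by
  constructor
  · rintro rfl; rfl
  · intro hdet
    ext i j
    have := congrArg (fun u : Aˣ => (u : A)) hdet
    simp only [Matrix.GeneralLinearGroup.val_det_apply, Matrix.det_fin_one] at this
    rw [Subsingleton.elim i 0, Subsingleton.elim j 0]
    exact this

/-- **Every continuous character `θ : Γ_K → Aˣ` is the determinant of a rank-one framed
representation** (`Aˣ ≃ₜ* GL_1(A)`, `FramedRep.unitsContinuousMulEquivOfUnique`). [folklore] -/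
theorem exists_framed_of_continuous (θ : absoluteGaloisGroup K →* Aˣ) (hθ : Continuous θ) :
    ∃ r : FramedGaloisRep K A 1, ∀ σ, Matrix.GeneralLinearGroup.det (r σ) = θ σ := by
  refine ⟨ContinuousMonoidHom.comp
    (FramedRep.unitsContinuousMulEquivOfUnique (Fin 1) A : Aˣ →ₜ* GL (Fin 1) A) ⟨θ, hθ⟩, fun σ => ?_⟩
  apply Units.ext
  rw [Matrix.GeneralLinearGroup.val_det_apply, Matrix.det_fin_one]
  rfl

/-- `r σ = 1 ↔ det (r σ) = 1` in rank one. [folklore] -/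
theorem framed_apply_eq_one_iff (r : FramedGaloisRep K A 1) (σ : absoluteGaloisGroup K) :
    r σ = 1 ↔ Matrix.GeneralLinearGroup.det (r σ) = 1 := by
  rw [gl_one_eq_iff_det_eq, map_one]

variable [NumberField K]

omit [NumberField K] in
/-- Unramifiedness of a rank-one framed representation in terms of its determinant character.
[folklore] -/
theorem isUnramifiedAt_iff_det (r : FramedGaloisRep K A 1) (θ : absoluteGaloisGroup K →* Aˣ)
    (hr : ∀ σ, Matrix.GeneralLinearGroup.det (r σ) = θ σ) (v : HeightOneSpectrum (𝓞 K)) :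
    r.IsUnramifiedAt v ↔
      ∀ 𝔓 ∈ v.primesAbove, ∀ σ ∈ 𝔓.inertia (absoluteGaloisGroup K), θ σ = 1 := by
  refine forall₂_congr fun 𝔓 _ => forall₂_congr fun σ _ => ?_
  rw [framed_apply_eq_one_iff, hr]

/-- Frobenius characteristic polynomials of a rank-one framed representation in terms of its
determinant character. [folklore] -/
theorem hasFrobCharpolyAt_iff_det (r : FramedGaloisRep K A 1) (θ : absoluteGaloisGroup K →* Aˣ)
    (hr : ∀ σ, Matrix.GeneralLinearGroup.det (r σ) = θ σ) (v : HeightOneSpectrum (𝓞 K)) (a : A) :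
    r.HasFrobCharpolyAt v (X - C a) ↔
      ∀ 𝔓 ∈ v.primesAbove, ∀ Φ : absoluteGaloisGroup K, IsArithFrobAt (𝓞 K) Φ 𝔓 →
        ((θ Φ : Aˣ) : A) = a := by
  rw [FramedGaloisRep.hasFrobCharpolyAt_iff_of_rank_one]
  refine forall₂_congr fun 𝔓 _ => forall₂_congr fun Φ _ => ?_
  rw [← hr, Matrix.GeneralLinearGroup.val_det_apply, Matrix.det_fin_one]

end Det

/-! ### §2. The avatar condition for plain characters: dictionary, products, inverses -/

section Avatar

variable {K : Type} [Field K] [NumberField K] {p : ℕ} [Fact p.Prime]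

omit [NumberField K] in
/-- **`FactorsThroughZp κ r` in determinant form**: `∀ σ, κ σ = 1 → θ σ = 1`. [folklore] -/
theorem factorsThroughZp_iff_det (κ : ZpExtension K p) (r : FramedGaloisRep K (PadicAlgCl p) 1)
    (θ : absoluteGaloisGroup K →* (PadicAlgCl p)ˣ)
    (hr : ∀ σ, Matrix.GeneralLinearGroup.det (r σ) = θ σ) :
    FactorsThroughZp κ r ↔ ∀ σ, κ σ = 1 → θ σ = 1 := by
  refine forall_congr' fun σ => imp_congr_right fun _ => ?_
  rw [framed_apply_eq_one_iff, hr]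

/-- **`IsPAdicAvatarOf ι χ r` in determinant form**: at every `v ∤ p` where `χ` is unramified, `θ`
kills the inertia above `v` and `θ(Φ) = ι⁻¹(χ(ϖ_v))⁻¹` at the arithmetic Frobenii.
[cite: CastellaHsieh2018, §3.3 (p. 9)] -/
theorem isPAdicAvatarOf_iff_det (ι : PadicAlgCl p ≃+* ℂ) (χ : HeckeCharacter K)
    (r : FramedGaloisRep K (PadicAlgCl p) 1) (θ : absoluteGaloisGroup K →* (PadicAlgCl p)ˣ)
    (hr : ∀ σ, Matrix.GeneralLinearGroup.det (r σ) = θ σ) :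
    IsPAdicAvatarOf ι χ r ↔
      ∀ v : HeightOneSpectrum (𝓞 K), ((p : ℕ) : 𝓞 K) ∉ v.asIdeal → χ.IsUnramifiedAt v →
        (∀ 𝔓 ∈ v.primesAbove, ∀ σ ∈ 𝔓.inertia (absoluteGaloisGroup K), θ σ = 1) ∧
        ∀ 𝔓 ∈ v.primesAbove, ∀ Φ : absoluteGaloisGroup K, IsArithFrobAt (𝓞 K) Φ 𝔓 →
          ((θ Φ : (PadicAlgCl p)ˣ) : PadicAlgCl p) = (ι.symm (χ.valueAtUniformizer v))⁻¹ := by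
  refine forall_congr' fun v => imp_congr_right fun _ => imp_congr_right fun _ => ?_
  rw [isUnramifiedAt_iff_det r θ hr, hasFrobCharpolyAt_iff_det r θ hr]

/-- **Products of avatars**: if `θᵢ` is an avatar of `χᵢ` and both `χ₁, χ₂` are unramified
outside `p`, then `θ₁θ₂` is an avatar of `χ₁χ₂` (`(χ₁χ₂)(ϖ_v) = χ₁(ϖ_v) χ₂(ϖ_v)` at places where
both are unramified, `valueAtUniformizer_mul'`). [cite: SerreAbelianLadic1968, Ch. II §2.7] -/
theorem avatar_mul (ι : PadicAlgCl p ≃+* ℂ) {χ₁ χ₂ : HeckeCharacter K}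
    {θ₁ θ₂ : absoluteGaloisGroup K →* (PadicAlgCl p)ˣ}
    (hu₁ : ∀ v : HeightOneSpectrum (𝓞 K), ((p : ℕ) : 𝓞 K) ∉ v.asIdeal → χ₁.IsUnramifiedAt v)
    (hu₂ : ∀ v : HeightOneSpectrum (𝓞 K), ((p : ℕ) : 𝓞 K) ∉ v.asIdeal → χ₂.IsUnramifiedAt v)
    (h₁ : ∀ v : HeightOneSpectrum (𝓞 K), ((p : ℕ) : 𝓞 K) ∉ v.asIdeal → χ₁.IsUnramifiedAt v →
      (∀ 𝔓 ∈ v.primesAbove, ∀ σ ∈ 𝔓.inertia (absoluteGaloisGroup K), θ₁ σ = 1) ∧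
      ∀ 𝔓 ∈ v.primesAbove, ∀ Φ : absoluteGaloisGroup K, IsArithFrobAt (𝓞 K) Φ 𝔓 →
        ((θ₁ Φ : (PadicAlgCl p)ˣ) : PadicAlgCl p) = (ι.symm (χ₁.valueAtUniformizer v))⁻¹)
    (h₂ : ∀ v : HeightOneSpectrum (𝓞 K), ((p : ℕ) : 𝓞 K) ∉ v.asIdeal → χ₂.IsUnramifiedAt v →
      (∀ 𝔓 ∈ v.primesAbove, ∀ σ ∈ 𝔓.inertia (absoluteGaloisGroup K), θ₂ σ = 1) ∧
      ∀ 𝔓 ∈ v.primesAbove, ∀ Φ : absoluteGaloisGroup K, IsArithFrobAt (𝓞 K) Φ 𝔓 →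
        ((θ₂ Φ : (PadicAlgCl p)ˣ) : PadicAlgCl p) = (ι.symm (χ₂.valueAtUniformizer v))⁻¹) :
    ∀ v : HeightOneSpectrum (𝓞 K), ((p : ℕ) : 𝓞 K) ∉ v.asIdeal → (χ₁ * χ₂).IsUnramifiedAt v →
      (∀ 𝔓 ∈ v.primesAbove, ∀ σ ∈ 𝔓.inertia (absoluteGaloisGroup K), (θ₁ * θ₂) σ = 1) ∧
      ∀ 𝔓 ∈ v.primesAbove, ∀ Φ : absoluteGaloisGroup K, IsArithFrobAt (𝓞 K) Φ 𝔓 →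
        (((θ₁ * θ₂) Φ : (PadicAlgCl p)ˣ) : PadicAlgCl p) =
          (ι.symm ((χ₁ * χ₂).valueAtUniformizer v))⁻¹ := by
  intro v hv _
  obtain ⟨hI₁, hF₁⟩ := h₁ v hv (hu₁ v hv)
  obtain ⟨hI₂, hF₂⟩ := h₂ v hv (hu₂ v hv)
  refine ⟨fun 𝔓 h𝔓 σ hσ => ?_, fun 𝔓 h𝔓 Φ hΦ => ?_⟩
  · rw [MonoidHom.mul_apply, hI₁ 𝔓 h𝔓 σ hσ, hI₂ 𝔓 h𝔓 σ hσ, one_mul]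
  · rw [MonoidHom.mul_apply, Units.val_mul, hF₁ 𝔓 h𝔓 Φ hΦ, hF₂ 𝔓 h𝔓 Φ hΦ,
      HeckeCharacter.valueAtUniformizer_mul' χ₁ χ₂ v, map_mul, mul_inv]

/-- **Inverses of avatars**: if `θ` is an avatar of `χ`, unramified outside `p`, then `θ⁻¹` is an
avatar of `χ⁻¹`. [cite: SerreAbelianLadic1968, Ch. II §2.7] -/
theorem avatar_inv (ι : PadicAlgCl p ≃+* ℂ) {χ : HeckeCharacter K}
    {θ : absoluteGaloisGroup K →* (PadicAlgCl p)ˣ}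
    (hu : ∀ v : HeightOneSpectrum (𝓞 K), ((p : ℕ) : 𝓞 K) ∉ v.asIdeal → χ.IsUnramifiedAt v)
    (h : ∀ v : HeightOneSpectrum (𝓞 K), ((p : ℕ) : 𝓞 K) ∉ v.asIdeal → χ.IsUnramifiedAt v →
      (∀ 𝔓 ∈ v.primesAbove, ∀ σ ∈ 𝔓.inertia (absoluteGaloisGroup K), θ σ = 1) ∧
      ∀ 𝔓 ∈ v.primesAbove, ∀ Φ : absoluteGaloisGroup K, IsArithFrobAt (𝓞 K) Φ 𝔓 →
        ((θ Φ : (PadicAlgCl p)ˣ) : PadicAlgCl p) = (ι.symm (χ.valueAtUniformizer v))⁻¹) :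
    ∀ v : HeightOneSpectrum (𝓞 K), ((p : ℕ) : 𝓞 K) ∉ v.asIdeal → χ⁻¹.IsUnramifiedAt v →
      (∀ 𝔓 ∈ v.primesAbove, ∀ σ ∈ 𝔓.inertia (absoluteGaloisGroup K), θ⁻¹ σ = 1) ∧
      ∀ 𝔓 ∈ v.primesAbove, ∀ Φ : absoluteGaloisGroup K, IsArithFrobAt (𝓞 K) Φ 𝔓 →
        ((θ⁻¹ Φ : (PadicAlgCl p)ˣ) : PadicAlgCl p) = (ι.symm (χ⁻¹.valueAtUniformizer v))⁻¹ := by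
  intro v hv _
  obtain ⟨hI, hF⟩ := h v hv (hu v hv)
  refine ⟨fun 𝔓 h𝔓 σ hσ => ?_, fun 𝔓 h𝔓 Φ hΦ => ?_⟩
  · rw [MonoidHom.inv_apply, hI 𝔓 h𝔓 σ hσ, inv_one]
  · rw [MonoidHom.inv_apply, Units.val_inv_eq_inv_val, hF 𝔓 h𝔓 Φ hΦ,
      HeckeCharacter.valueAtUniformizer_inv' χ v, map_inv₀]

/-! ### §3. Weil 1956: algebraic Hecke characters have continuous avatars -/

/-- **Weil's avatar as a plain continuous character** (the tree's PROVED
`HeckeCharacter.IsAlgebraic.exists_lAdic`, read through the determinant): for an algebraic Hecke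
character `χ` there is a CONTINUOUS `θ : Γ_K →* ℚ̄_pˣ` which is an avatar of `χ`.
[cite: Weil1956, §1–§2] [cite: SerreAbelianLadic1968, Ch. II §2.7–2.8] -/
theorem exists_avatar_of_isAlgebraic (ι : PadicAlgCl p ≃+* ℂ) {χ : HeckeCharacter K}
    (hχ : χ.IsAlgebraic) :
    ∃ θ : absoluteGaloisGroup K →* (PadicAlgCl p)ˣ, Continuous θ ∧
      ∀ v : HeightOneSpectrum (𝓞 K), ((p : ℕ) : 𝓞 K) ∉ v.asIdeal → χ.IsUnramifiedAt v →
        (∀ 𝔓 ∈ v.primesAbove, ∀ σ ∈ 𝔓.inertia (absoluteGaloisGroup K), θ σ = 1) ∧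
        ∀ 𝔓 ∈ v.primesAbove, ∀ Φ : absoluteGaloisGroup K, IsArithFrobAt (𝓞 K) Φ 𝔓 →
          ((θ Φ : (PadicAlgCl p)ˣ) : PadicAlgCl p) = (ι.symm (χ.valueAtUniformizer v))⁻¹ := by
  obtain ⟨r, hr⟩ := hχ.exists_lAdic ι
  refine ⟨(FramedRep.det r).toMonoidHom, (FramedRep.det r).continuous, ?_⟩
  have hdet : ∀ σ, Matrix.GeneralLinearGroup.det (r σ) = (FramedRep.det r).toMonoidHom σ :=
    fun σ => rfl
  refine fun v hv hu => ⟨(isUnramifiedAt_iff_det r _ hdet v).mp (hr v hv hu).1, ?_⟩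
  have h2 := (hr v hv hu).2
  rw [map_inv₀] at h2
  exact (hasFrobCharpolyAt_iff_det r _ hdet v _).mp h2

/-! ### §4. Finite order: open-kernel characters are avatars of finite-order Hecke characters -/

/-- **A Hecke character of finite order has infinity type `(0, 0)`**: `x ↦ χ(x, 1)` is continuous
on `(K ⊗ ℝ)ˣ` with values in the `n`-th roots of unity, hence `= 1` near `1`.
-- adapted from Summits/Langlands/Langlands/Theorems/PicardMuOrdinaryResidualAutomorphyEvenHeckeAlgebra.lean
[cite: Weil1956, §1] -/
theorem hasInfinityType_zero_of_isFiniteOrder {χ : HeckeCharacter K} (hχ : χ.IsFiniteOrder) :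
    χ.HasInfinityType 0 0 := by
  obtain ⟨n, hn, h1⟩ := hχ.exists_pow_eq_one
  set f : (InfiniteAdeleRing K)ˣ → ℂ := fun x => (χ (infiniteIdeles K x) : ℂ) with hf
  have hinf : Continuous (infiniteIdeles K) := by
    refine Continuous.units_map (MonoidHom.inl (InfiniteAdeleRing K) (FiniteAdeleRing (𝓞 K) K)) ?_
    exact continuous_id.prodMk continuous_const
  have hcont : Continuous f := Units.continuous_val.comp ((map_continuous χ).comp hinf)
  have hpow : ∀ x, f x ^ n = 1 := fun x => by
    have h := congrArg (fun φ : HeckeCharacter K => ((φ (infiniteIdeles K x) : ℂˣ) : ℂ)) h1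
    simpa [HeckeCharacter.pow_apply, Units.val_pow_eq_pow_val] using h
  set S : Set ℂ := {z | z ^ n = 1 ∧ z ≠ 1} with hS
  have hSfin : S.Finite := by
    refine (Multiset.finite_toSet (Polynomial.nthRoots n (1 : ℂ))).subset fun z hz => ?_
    simp only [Set.mem_setOf_eq] at hz ⊢
    exact (Polynomial.mem_nthRoots hn).mpr hz.1
  have hopen : IsOpen (f ⁻¹' Sᶜ) := hSfin.isClosed.isOpen_compl.preimage hcont
  have hone : (1 : (InfiniteAdeleRing K)ˣ) ∈ f ⁻¹' Sᶜ := by simp [hf, hS]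
  refine ⟨f ⁻¹' Sᶜ, hopen.mem_nhds hone, fun x hx => ?_⟩
  have hx' : f x ∉ S := hx
  have hfx : f x = 1 := by
    by_contra hne
    exact hx' ⟨hpow x, hne⟩
  rw [HeckeCharacter.archFactor_apply]
  simp only [Pi.zero_apply, neg_zero, zpow_zero, mul_one, Finset.prod_const_one]
  exact hfx

/-- **The finite-order dictionary (global class field theory, PROVED in the tree).** Let
`θ : Γ_K →* ℚ̄_pˣ` have OPEN KERNEL. Then there is a Hecke character `μ` of FINITE ORDER such that
(i) `θ` is an avatar of `μ` — at every `v ∤ p` where `μ` is unramified, `θ` kills the inertia above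
`v` and `θ(Φ) = ι⁻¹(μ(ϖ_v))⁻¹` —, and (ii) `μ` is unramified at every finite `v` all of whose inertia
groups `θ` kills. Construction: `ψ := (σ ↦ ι(θ(σ)⁻¹)) : Γ_K → GL_1(ℂ)` (`FramedGaloisRep.ofOpenKer`),
`μ := heckeOfArtinCharacter` of `ψ` (Tate, Cassels–Fröhlich VII §5.1 (A); tree
`artinReciprocity_character_holds`), and the converse ramification clause is Neukirch VII (10.6)
Remark (tree `isUnramifiedAt_of_heckeCharacter_isUnramifiedAt`).
[cite: CasselsFrohlichANT1967, Ch. VII §5.1 Main Theorem (A), §4.2 Corollary]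
[cite: NeukirchANT1999, Ch. VII Thm. (10.6) Remark] -/
theorem exists_hecke_of_isOpen_ker (ι : PadicAlgCl p ≃+* ℂ) (θ : absoluteGaloisGroup K →* (PadicAlgCl p)ˣ)
    (hθ : IsOpen (θ.ker : Set (absoluteGaloisGroup K))) :
    ∃ μ : HeckeCharacter K, μ.IsFiniteOrder ∧
      (∀ v : HeightOneSpectrum (𝓞 K), ((p : ℕ) : 𝓞 K) ∉ v.asIdeal → μ.IsUnramifiedAt v →
        (∀ 𝔓 ∈ v.primesAbove, ∀ σ ∈ 𝔓.inertia (absoluteGaloisGroup K), θ σ = 1) ∧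
        ∀ 𝔓 ∈ v.primesAbove, ∀ Φ : absoluteGaloisGroup K, IsArithFrobAt (𝓞 K) Φ 𝔓 →
          ((θ Φ : (PadicAlgCl p)ˣ) : PadicAlgCl p) = (ι.symm (μ.valueAtUniformizer v))⁻¹) ∧
      ∀ v : HeightOneSpectrum (𝓞 K),
        (∀ 𝔓 ∈ v.primesAbove, ∀ σ ∈ 𝔓.inertia (absoluteGaloisGroup K), θ σ = 1) → μ.IsUnramifiedAt v := by
  -- the complex Artin character `ψ(σ) = ι(θ(σ)⁻¹)`
  set θℂ : absoluteGaloisGroup K →* ℂˣ := (Units.map ((ι : PadicAlgCl p ≃+* ℂ) : PadicAlgCl p →* ℂ)).comp θ⁻¹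
    with hθℂ
  have hθℂ_apply : ∀ σ, ((θℂ σ : ℂˣ) : ℂ) = ι (((θ σ)⁻¹ : (PadicAlgCl p)ˣ) : PadicAlgCl p) := fun σ => rfl
  have hker : ∀ σ, θℂ σ = 1 ↔ θ σ = 1 := fun σ => by
    constructor
    · intro h
      have h1 := congrArg (fun u : ℂˣ => (u : ℂ)) h
      simp only [hθℂ_apply, Units.val_one] at h1
      have h2 : (((θ σ)⁻¹ : (PadicAlgCl p)ˣ) : PadicAlgCl p) = 1 := by
        have := congrArg ι.symm h1
        rwa [RingEquiv.symm_apply_apply, map_one] at this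
      exact inv_eq_one.mp (Units.val_eq_one.mp h2)
    · intro h
      apply Units.ext
      rw [hθℂ_apply, h, inv_one, Units.val_one, map_one, Units.val_one]
  have hθℂ_open : IsOpen (θℂ.ker : Set (absoluteGaloisGroup K)) := by
    have : (θℂ.ker : Set (absoluteGaloisGroup K)) = θ.ker := by
      ext σ
      simp only [SetLike.mem_coe, MonoidHom.mem_ker]
      exact hker σ
    rw [this]
    exact hθ
  set ψ : FramedArtinRep K 1 := FramedGaloisRep.ofOpenKer θℂ hθℂ_open with hψ
  -- its Hecke character
  set μ := heckeOfArtinCharacter artinReciprocity_character_holds ψ with hμ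
  obtain ⟨hfin, hspec⟩ := heckeOfArtinCharacter_spec artinReciprocity_character_holds ψ
  -- `ψ` unramified at `v` iff `θ` kills the inertia above `v`
  have hψunr : ∀ v : HeightOneSpectrum (𝓞 K), ψ.IsUnramifiedAt v ↔
      ∀ 𝔓 ∈ v.primesAbove, ∀ σ ∈ 𝔓.inertia (absoluteGaloisGroup K), θ σ = 1 := fun v => by
    rw [hψ, FramedGaloisRep.isUnramifiedAt_ofOpenKer_iff]
    refine forall₂_congr fun 𝔓 _ => forall₂_congr fun σ _ => hker σ
  -- the converse ramification clause: `μ` unramified ⟹ `ψ` unramified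
  have hdet : ∀ v : HeightOneSpectrum (𝓞 K), ψ.IsUnramifiedAt v →
      μ.IsUnramifiedAt v ∧ ∀ 𝔓 ∈ v.primesAbove, ∀ Φ : absoluteGaloisGroup K,
        IsArithFrobAt (𝓞 K) Φ 𝔓 → μ.valueAtUniformizer v = ((FramedRep.det ψ Φ : ℂˣ) : ℂ) := by
    intro v hv
    refine ⟨(hspec v hv).1, fun 𝔓 h𝔓 Φ hΦ => ?_⟩
    have h := (FramedGaloisRep.hasFrobCharpolyAt_iff_of_rank_one ψ v _).mp (hspec v hv).2 𝔓 h𝔓 Φ hΦ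
    rw [← h, FramedRep.det_apply, Matrix.GeneralLinearGroup.val_det_apply, Matrix.det_fin_one]
  have hconv : ∀ v : HeightOneSpectrum (𝓞 K), μ.IsUnramifiedAt v → ψ.IsUnramifiedAt v :=
    fun v hv => isUnramifiedAt_of_heckeCharacter_isUnramifiedAt ψ μ hdet v hv
  refine ⟨μ, hfin, fun v _ hv => ?_, fun v hv => (hspec v ((hψunr v).mpr hv)).1⟩
  have hψv := hconv v hv
  refine ⟨(hψunr v).mp hψv, fun 𝔓 h𝔓 Φ hΦ => ?_⟩
  have h := (FramedGaloisRep.hasFrobCharpolyAt_ofOpenKer_iff θℂ hθℂ_open v _).mp (hspec v hψv).2 𝔓 h𝔓 Φ hΦ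
  -- `h : ι (θ Φ)⁻¹ = μ(ϖ_v)`
  rw [hθℂ_apply, Units.val_inv_eq_inv_val] at h
  rw [← h, RingEquiv.symm_apply_apply, inv_inv]

end Avatar

end Summit.BirchSwinnertonDyer.Rank1Residual.X11b.Three.LambdaSupply

end
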